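import Summits.PneNP.PneNP.Theorems.CodingVolumeShiftsCodingVolumeEntropyCredit

/-!
# Route CodingVolumeShifts — crux `CodingVolume` (stmt-PneNP-19454): the per-level entropy
# inequality (general one-shot codes)

Entropy translation of `codingVolume_linear_sum_T` / `…_sum_SU` / `…_sinks` / `…_level` for an
ARBITRARY binary one-shot code on a `4`-far k-pairs network (notation of
`CodingVolumeShiftsCodingVolumeEntropyCredit`; `A_r` = commodities of level `r`):

* `codingVolume_entropy_sum_T` — effective arcs out of the level-`r` sources:
  `Σ_{v middle} |T v| ≥ |A_r| + |A_r ∖ A1|`;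
* `codingVolume_entropy_sinks` — in-arcs of the level-`r` sinks plus pure sinks recorded at their
  feeders: `Σ_{i ∈ A_r} |In(sink i)| + Σ_{v middle} |P v| ≥ 2|A_r|`;
* `codingVolume_entropy_departure_count` — DEPARTURE COUNT: `|A1| ≤ Σ_{v middle} H(UA v | x|_C)`
  (finite conditional subadditivity over the receiving vertices, and `x|_{A1}` is a function of
  the bits on all arcs from rank-`r` middle vertices into middle vertices together with `x|_C`,
  `codingVolume_departure`);
* `codingVolume_entropy_level` — **PER-LEVEL INEQUALITY**:
  `Σ_{v middle} H(In v | x|_{B'}) + 4·|A_r| ≤ Σ_{v middle} H(In v | x|_B) + Σ_{i ∈ A_r} |In(sink i)|`.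

No definitions. [folklore]
-/

set_option linter.dupNamespace false -- `Summit.PneNP.PneNP.…`: summit = sub-problem name (D-0017)

namespace Summit.PneNP.PneNP.Theorems

open Literature.InformationTheory.NetworkCoding Literature.InformationTheory.Entropy Finset

section Level

variable {ι : Type} [Fintype ι] [DecidableEq ι] {N : KPairsNet ι}

open scoped Classical in
/-- EFFECTIVE ARCS OUT OF THE LEVEL-`r` SOURCES (general codes). Summing over the middle vertices
`v` the number of level-`r` commodities with an effective arc into `v` counts every level-`r`
commodity at least once, and those entering the middle of the network at two or more vertices at
least twice. [folklore] -/
theorem codingVolume_entropy_sum_T (c : N.Code) (hr : ι → ℕ)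
    (hrA : ∀ i, ∃ a, N.src a = N.source i ∧ (∀ l, N.tgt a ≠ N.sink l) ∧
      (∃ y y' : ι → Bool, c.val a y ≠ c.val a y') ∧ N.rank (N.tgt a) = hr i)
    (r : ℕ) (A1 : Finset ι)
    (hA1 : ∀ j, j ∈ A1 ↔ hr j = r ∧ ∀ a a', N.src a = N.source j → N.src a' = N.source j →
      (∀ l, N.tgt a ≠ N.sink l) → (∀ l, N.tgt a' ≠ N.sink l) →
      (∃ y y' : ι → Bool, c.val a y ≠ c.val a y') → (∃ y y' : ι → Bool, c.val a' y ≠ c.val a' y') →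
      N.tgt a = N.tgt a') :
    (univ.filter fun i => hr i = r).card + ((univ.filter fun i => hr i = r).filter (· ∉ A1)).card ≤
      ∑ v ∈ univ.filter (fun v : N.V => (∀ j, v ≠ N.source j) ∧ ∀ j, v ≠ N.sink j),
        ((univ.filter fun i => hr i = r).filter
          (fun i => ∃ a, N.src a = N.source i ∧ N.tgt a = v ∧
            ∃ y y' : ι → Bool, c.val a y ≠ c.val a y')).card := by
  set A := univ.filter (fun i => hr i = r) with hA
  set Mset := univ.filter (fun v : N.V => (∀ j, v ≠ N.source j) ∧ ∀ j, v ≠ N.sink j) with hM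
  -- double counting
  have hswap : ∑ v ∈ Mset, (A.filter (fun i => ∃ a, N.src a = N.source i ∧ N.tgt a = v ∧
      ∃ y y' : ι → Bool, c.val a y ≠ c.val a y')).card =
      ∑ i ∈ A, (Mset.filter (fun v => ∃ a, N.src a = N.source i ∧ N.tgt a = v ∧
      ∃ y y' : ι → Bool, c.val a y ≠ c.val a y')).card := by
    simp_rw [Finset.card_filter]
    exact Finset.sum_comm
  rw [hswap]
  -- per commodity
  have hper : ∀ i ∈ A, 1 + (if i ∉ A1 then 1 else 0) ≤
      (Mset.filter (fun v => ∃ a, N.src a = N.source i ∧ N.tgt a = v ∧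
        ∃ y y' : ι → Bool, c.val a y ≠ c.val a y')).card := by
    intro i hi
    have hir : hr i = r := (Finset.mem_filter.mp hi).2
    have hmemM : ∀ a, N.src a = N.source i → (∀ l, N.tgt a ≠ N.sink l) →
        (∃ y y' : ι → Bool, c.val a y ≠ c.val a y') →
        N.tgt a ∈ Mset.filter (fun v => ∃ a, N.src a = N.source i ∧ N.tgt a = v ∧
          ∃ y y' : ι → Bool, c.val a y ≠ c.val a y') := by
      intro a ha haM hz
      rw [Finset.mem_filter, hM, Finset.mem_filter]
      exact ⟨⟨Finset.mem_univ _, fun j h => N.source_in a j h, fun j h => haM j h⟩, a, ha, rfl, hz⟩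
    obtain ⟨a, ha, haM, hz, -⟩ := hrA i
    by_cases hiA : i ∈ A1
    · rw [if_neg (not_not.mpr hiA), Nat.add_zero]
      exact Finset.card_pos.mpr ⟨_, hmemM a ha haM hz⟩
    · -- not in `A1`: two effective arcs with different middle heads
      rw [if_pos hiA]
      have : ¬ ∀ a a', N.src a = N.source i → N.src a' = N.source i →
          (∀ l, N.tgt a ≠ N.sink l) → (∀ l, N.tgt a' ≠ N.sink l) →
          (∃ y y' : ι → Bool, c.val a y ≠ c.val a y') →
          (∃ y y' : ι → Bool, c.val a' y ≠ c.val a' y') →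
          N.tgt a = N.tgt a' := fun h => hiA ((hA1 i).mpr ⟨hir, h⟩)
      push Not at this
      obtain ⟨b, b', hb, hb', hbM, hb'M, hbz, hb'z, hne⟩ := this
      rw [show (1 : ℕ) + 1 = ({N.tgt b, N.tgt b'} : Finset N.V).card by
        rw [Finset.card_pair hne]]
      refine Finset.card_le_card ?_
      intro v hv
      rcases Finset.mem_insert.mp hv with rfl | hv
      · exact hmemM b hb hbM hbz
      · rw [Finset.mem_singleton] at hv; subst hv; exact hmemM b' hb' hb'M hb'z
  calc A.card + (A.filter (· ∉ A1)).card
      = ∑ i ∈ A, (1 + if i ∉ A1 then 1 else 0) := by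
        rw [Finset.sum_add_distrib, Finset.card_eq_sum_ones, Finset.card_filter]
    _ ≤ _ := Finset.sum_le_sum hper

/-- SINKS OF LEVEL `r` (general codes): the in-arcs of the sinks of the level-`r` commodities, plus
the number of those sinks with a single in-arc (each recorded at the middle vertex feeding it), are
at least `2·|A_r|` (a sink has an in-arc by decodability; a single in-arc has a middle tail for a
`2`-far pair). [folklore] -/
theorem codingVolume_entropy_sinks (c : N.Code) (hfar : N.Far 4) (hr : ι → ℕ) (r : ℕ) :
    2 * (univ.filter fun i => hr i = r).card ≤
      ∑ i ∈ univ.filter (fun i => hr i = r), (N.inArcs (N.sink i)).card +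
      ∑ v ∈ univ.filter (fun v : N.V => (∀ j, v ≠ N.source j) ∧ ∀ j, v ≠ N.sink j),
        ((univ.filter fun i => hr i = r).filter (fun i => (N.inArcs (N.sink i)).card ≤ 1 ∧
          ∃ b ∈ N.inArcs (N.sink i), N.src b = v)).card := by
  classical
  set A := univ.filter (fun i => hr i = r) with hA
  set Mset := univ.filter (fun v : N.V => (∀ j, v ≠ N.source j) ∧ ∀ j, v ≠ N.sink j) with hM
  set Pure := A.filter (fun i => (N.inArcs (N.sink i)).card ≤ 1) with hPure
  have hfar2 : ∀ i, (2 : ℕ∞) ≤ N.graph.edist (N.source i) (N.sink i) := fun i =>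
    le_trans (by exact_mod_cast (by norm_num : (2 : ℕ) ≤ 4)) (hfar i)
  -- a sink with at most one in-arc has exactly one, `b`, with a middle tail
  have hpure : ∀ i, (N.inArcs (N.sink i)).card ≤ 1 → ∃ b, N.inArcs (N.sink i) = {b} ∧
      (∀ l, N.src b ≠ N.source l) ∧ (∀ l, N.src b ≠ N.sink l) := by
    intro i hc
    obtain ⟨b₀, hb₀, -⟩ := codingVolume_exists_dep_inArc_sink c i
    have hmem : b₀ ∈ N.inArcs (N.sink i) := by simp [KPairsNet.inArcs, hb₀]
    have h1 : (N.inArcs (N.sink i)).card = 1 := le_antisymm hc (Finset.card_pos.mpr ⟨b₀, hmem⟩)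
    obtain ⟨b, hb⟩ := Finset.card_eq_one.mp h1
    obtain ⟨hs, ht, -⟩ := codingVolume_single_inArc_tail c i b hb (hfar2 i)
    exact ⟨b, hb, hs, ht⟩
  -- per sink: `|In| + [pure] ≥ 2`
  have hper : ∀ i ∈ A, 2 ≤ (N.inArcs (N.sink i)).card + (if i ∈ Pure then 1 else 0) := by
    intro i hi
    by_cases hc : (N.inArcs (N.sink i)).card ≤ 1
    · obtain ⟨b, hb, -⟩ := hpure i hc
      have hmem : i ∈ Pure := by rw [hPure, Finset.mem_filter]; exact ⟨hi, hc⟩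
      rw [if_pos hmem, hb, Finset.card_singleton]
    · push Not at hc
      omega
  have h1 : 2 * A.card ≤ ∑ i ∈ A, (N.inArcs (N.sink i)).card + Pure.card := by
    calc 2 * A.card = ∑ _i ∈ A, 2 := by simp [mul_comm]
      _ ≤ ∑ i ∈ A, ((N.inArcs (N.sink i)).card + if i ∈ Pure then 1 else 0) :=
          Finset.sum_le_sum hper
      _ = ∑ i ∈ A, (N.inArcs (N.sink i)).card + Pure.card := by
          rw [Finset.sum_add_distrib, Finset.sum_ite_mem,
            Finset.inter_eq_right.mpr (Finset.filter_subset _ _), Finset.card_eq_sum_ones]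
  -- the pure sinks are recorded at the middle vertices feeding them
  have h2 : Pure.card ≤ ∑ v ∈ Mset, (A.filter (fun i => (N.inArcs (N.sink i)).card ≤ 1 ∧
      ∃ b ∈ N.inArcs (N.sink i), N.src b = v)).card := by
    refine le_trans (Finset.card_le_card ?_) Finset.card_biUnion_le
    intro i hi
    rw [hPure, Finset.mem_filter] at hi
    obtain ⟨b, hb, hbs, hbt⟩ := hpure i hi.2
    rw [Finset.mem_biUnion]
    refine ⟨N.src b, ?_, ?_⟩
    · rw [hM, Finset.mem_filter]
      exact ⟨Finset.mem_univ _, fun j h => hbs j h, fun j h => hbt j h⟩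
    · rw [Finset.mem_filter]
      exact ⟨hi.1, hi.2, b, by rw [hb]; exact Finset.mem_singleton_self b, rfl⟩
  omega

open scoped Classical in
/-- **DEPARTURE COUNT** (general codes): with `A1` the level-`r` commodities entering the middle of
the network at a single vertex and `C = {hr < r} ∪ (level r ∖ A1)`,
`|A1| ≤ Σ_{v middle} H(UA v | x|_C)`, where `UA v` are the arcs into `v` from rank-`r` middle
vertices: by finite conditional subadditivity the sum dominates the conditional entropy of the
bits on ALL arcs from rank-`r` middle vertices into middle vertices, which together with `x|_C`
determine `x|_{A1}` (`codingVolume_departure`), `|A1|` fresh bits. [folklore] -/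
theorem codingVolume_entropy_departure_count (c : N.Code) (hfar : N.Far 4) (hr : ι → ℕ)
    (hrA : ∀ i, ∃ a, N.src a = N.source i ∧ (∀ l, N.tgt a ≠ N.sink l) ∧
      (∃ y y' : ι → Bool, c.val a y ≠ c.val a y') ∧ N.rank (N.tgt a) = hr i)
    (hhr : ∀ i a, N.src a = N.source i → (∀ l, N.tgt a ≠ N.sink l) →
      (∃ y y' : ι → Bool, c.val a y ≠ c.val a y') → hr i ≤ N.rank (N.tgt a))
    (r : ℕ) (A1 : Finset ι)
    (hA1 : ∀ j, j ∈ A1 ↔ hr j = r ∧ ∀ a a', N.src a = N.source j → N.src a' = N.source j →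
      (∀ l, N.tgt a ≠ N.sink l) → (∀ l, N.tgt a' ≠ N.sink l) →
      (∃ y y' : ι → Bool, c.val a y ≠ c.val a y') → (∃ y y' : ι → Bool, c.val a' y ≠ c.val a' y') →
      N.tgt a = N.tgt a')
    (C : Finset ι) (hC : ∀ j, j ∈ C ↔ hr j < r ∨ (hr j = r ∧ j ∉ A1)) :
    (A1.card : ℝ) ≤
      ∑ v ∈ univ.filter (fun v : N.V => (∀ j, v ≠ N.source j) ∧ ∀ j, v ≠ N.sink j),
        (mapEntropy (univ : Finset (ι → Bool)) (fun x =>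
            ((fun b => if b ∈ univ.filter (fun b => N.tgt b = v ∧ (∀ j, N.src b ≠ N.source j) ∧
              N.rank (N.src b) = r) then c.val b x else false),
              (fun j => if j ∈ C then x j else false))) -
          mapEntropy (univ : Finset (ι → Bool)) (fun x => fun j => if j ∈ C then x j else false)) := by
  set Mset := univ.filter (fun v : N.V => (∀ j, v ≠ N.source j) ∧ ∀ j, v ≠ N.sink j) with hM
  let UA : N.V → Finset N.A := fun v => univ.filter (fun b => N.tgt b = v ∧
    (∀ j, N.src b ≠ N.source j) ∧ N.rank (N.src b) = r)
  let xC : (ι → Bool) → (ι → Bool) := fun x j => if j ∈ C then x j else false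
  let xA : (ι → Bool) → (ι → Bool) := fun x j => if j ∈ A1 then x j else false
  let Uall : (ι → Bool) → (N.A → Bool) := fun x b =>
    if b ∈ Mset.biUnion UA then c.val b x else false
  -- finite conditional subadditivity over the receiving vertices
  have hsub : mapEntropy univ (fun x => (Uall x, xC x)) - mapEntropy univ xC ≤
      ∑ v ∈ Mset, (mapEntropy univ (fun x => ((fun b => if b ∈ UA v then c.val b x else false),
        xC x)) - mapEntropy univ xC) :=
    codingVolume_mask_biUnion_le univ (fun x b => c.val b x) xC Mset UA
  -- `x|_{A1}` is determined by `(Uall, x|_C)`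
  have hdet : ∀ x ∈ (univ : Finset (ι → Bool)), ∀ x' ∈ (univ : Finset (ι → Bool)),
      Uall x = Uall x' → xC x = xC x' → xA x = xA x' := by
    intro x _ x' _ hU hxC
    have hU' : ∀ b ∈ Mset.biUnion UA, c.val b x = c.val b x' :=
      (codingVolume_mask_eq_iff (Mset.biUnion UA) (fun x b => c.val b x) x x').mp hU
    have hC' : ∀ j ∈ C, x j = x' j := (codingVolume_mask_eq_iff C (fun x j => x j) x x').mp hxC
    refine (codingVolume_mask_eq_iff A1 (fun x j => x j) x x').mpr fun i hi => ?_
    refine codingVolume_departure c hfar hr hrA hhr r A1 hA1 (fun j hj => hC' j ((hC j).mpr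
      (Or.inl hj))) (fun j hj hjA => hC' j ((hC j).mpr (Or.inr ⟨hj, hjA⟩))) (fun b hbM hbr hbt =>
      hU' b ?_) i hi
    rw [Finset.mem_biUnion]
    refine ⟨N.tgt b, ?_, ?_⟩
    · rw [hM, Finset.mem_filter]
      exact ⟨Finset.mem_univ _, fun j h => N.source_in b j h, fun j h => hbt j h⟩
    · exact Finset.mem_filter.mpr ⟨Finset.mem_univ _, rfl, hbM, hbr⟩
  have hle : mapEntropy univ (fun x => (xA x, xC x)) ≤ mapEntropy univ (fun x => (Uall x, xC x)) :=
    codingVolume_ent_pair_le_of_determined univ xA Uall xC hdet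
  -- `|A1|` fresh bits
  have hfresh : mapEntropy univ (fun x => (xA x, xC x)) - mapEntropy univ xC = A1.card := by
    refine codingVolume_ent_coords_cond A1 xC fun x x' h => ?_
    refine (codingVolume_mask_eq_iff C (fun x j => x j) x x').mpr fun j hj => h j fun hjA => ?_
    have hjr : hr j = r := ((hA1 j).mp hjA).1
    rcases (hC j).mp hj with hlt | ⟨-, hjA'⟩
    · exact absurd hjr (Nat.ne_of_lt hlt)
    · exact hjA' hjA
  have key : (A1.card : ℝ) ≤ ∑ v ∈ Mset, (mapEntropy univ (fun x =>
      ((fun b => if b ∈ UA v then c.val b x else false), xC x)) - mapEntropy univ xC) := by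
    linarith
  exact key

/-- **PER-LEVEL INEQUALITY** (general codes). For a `4`-far network with a one-shot code, with
`B = {hr < r}`, `B' = {hr < r + 1}` and `A_r = {hr = r}`:
`Σ_{v middle} H(In v | x|_{B'}) + 4·|A_r| ≤ Σ_{v middle} H(In v | x|_B) + Σ_{i ∈ A_r} |In(sink i)|`.
[folklore] -/
theorem codingVolume_entropy_level (c : N.Code) (hfar : N.Far 4) (hr : ι → ℕ)
    (hrA : ∀ i, ∃ a, N.src a = N.source i ∧ (∀ l, N.tgt a ≠ N.sink l) ∧
      (∃ y y' : ι → Bool, c.val a y ≠ c.val a y') ∧ N.rank (N.tgt a) = hr i)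
    (hhr : ∀ i a, N.src a = N.source i → (∀ l, N.tgt a ≠ N.sink l) →
      (∃ y y' : ι → Bool, c.val a y ≠ c.val a y') → hr i ≤ N.rank (N.tgt a))
    (r : ℕ) (B B' : Finset ι) (hB : ∀ j, j ∈ B ↔ hr j < r) (hB' : ∀ j, j ∈ B' ↔ hr j < r + 1) :
    (∑ v ∈ univ.filter (fun v : N.V => (∀ j, v ≠ N.source j) ∧ ∀ j, v ≠ N.sink j),
        (mapEntropy (univ : Finset (ι → Bool)) (fun x => ((fun b => if b ∈ N.inArcs v then
            c.val b x else false), (fun j => if j ∈ B' then x j else false))) -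
          mapEntropy (univ : Finset (ι → Bool)) (fun x => fun j => if j ∈ B' then x j else false))) +
      4 * ((univ.filter fun i => hr i = r).card : ℝ) ≤
    (∑ v ∈ univ.filter (fun v : N.V => (∀ j, v ≠ N.source j) ∧ ∀ j, v ≠ N.sink j),
        (mapEntropy (univ : Finset (ι → Bool)) (fun x => ((fun b => if b ∈ N.inArcs v then
            c.val b x else false), (fun j => if j ∈ B then x j else false))) -
          mapEntropy (univ : Finset (ι → Bool)) (fun x => fun j => if j ∈ B then x j else false))) +
      ∑ i ∈ univ.filter (fun i => hr i = r), ((N.inArcs (N.sink i)).card : ℝ) := by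
  classical
  set A := univ.filter (fun i => hr i = r) with hA
  set Mset := univ.filter (fun v : N.V => (∀ j, v ≠ N.source j) ∧ ∀ j, v ≠ N.sink j) with hM
  set A1 := A.filter (fun j => ∀ a a', N.src a = N.source j → N.src a' = N.source j →
      (∀ l, N.tgt a ≠ N.sink l) → (∀ l, N.tgt a' ≠ N.sink l) →
      (∃ y y' : ι → Bool, c.val a y ≠ c.val a y') → (∃ y y' : ι → Bool, c.val a' y ≠ c.val a' y') →
      N.tgt a = N.tgt a') with hA1def
  have hA1 : ∀ j, j ∈ A1 ↔ hr j = r ∧ ∀ a a', N.src a = N.source j → N.src a' = N.source j →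
      (∀ l, N.tgt a ≠ N.sink l) → (∀ l, N.tgt a' ≠ N.sink l) →
      (∃ y y' : ι → Bool, c.val a y ≠ c.val a y') → (∃ y y' : ι → Bool, c.val a' y ≠ c.val a' y') →
      N.tgt a = N.tgt a' := by
    intro j; rw [hA1def, Finset.mem_filter, hA, Finset.mem_filter]; simp
  set C := univ.filter (fun j => hr j < r ∨ (hr j = r ∧ j ∉ A1)) with hCdef
  have hC : ∀ j, j ∈ C ↔ hr j < r ∨ (hr j = r ∧ j ∉ A1) := by
    intro j; rw [hCdef, Finset.mem_filter]; simp
  -- the three global counts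
  have hT := codingVolume_entropy_sum_T c hr hrA r A1 hA1
  have hS := codingVolume_entropy_sinks c hfar hr r
  have hD := codingVolume_entropy_departure_count c hfar hr hrA hhr r A1 hA1 C hC
  rw [← hA, ← hM] at hT hS
  rw [← hM] at hD
  -- per-vertex credits, summed
  have hV : ∀ v ∈ Mset,
      (mapEntropy (univ : Finset (ι → Bool)) (fun x => ((fun b => if b ∈ N.inArcs v then
          c.val b x else false), (fun j => if j ∈ B' then x j else false))) -
        mapEntropy (univ : Finset (ι → Bool)) (fun x => fun j => if j ∈ B' then x j else false)) +
      ((A.filter (fun i => ∃ a, N.src a = N.source i ∧ N.tgt a = v ∧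
        ∃ y y' : ι → Bool, c.val a y ≠ c.val a y')).card : ℝ) +
      (mapEntropy (univ : Finset (ι → Bool)) (fun x =>
          ((fun b => if b ∈ univ.filter (fun b => N.tgt b = v ∧ (∀ j, N.src b ≠ N.source j) ∧
            N.rank (N.src b) = r) then c.val b x else false),
            (fun j => if j ∈ C then x j else false))) -
        mapEntropy (univ : Finset (ι → Bool)) (fun x => fun j => if j ∈ C then x j else false)) +
      ((A.filter (fun i => (N.inArcs (N.sink i)).card ≤ 1 ∧
        ∃ b ∈ N.inArcs (N.sink i), N.src b = v)).card : ℝ) ≤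
      mapEntropy (univ : Finset (ι → Bool)) (fun x => ((fun b => if b ∈ N.inArcs v then
          c.val b x else false), (fun j => if j ∈ B then x j else false))) -
        mapEntropy (univ : Finset (ι → Bool)) (fun x => fun j => if j ∈ B then x j else false) := by
    intro v hv
    rw [hM, Finset.mem_filter] at hv
    refine codingVolume_entropy_vertex c hfar hr hrA hhr r A1 hA1 B B' C hB hB' hC v hv.2.2
      _ (fun i => ?_) _ (fun i => ?_) _ (fun b => ?_)
    · rw [Finset.mem_filter, hA, Finset.mem_filter]; simp
    · rw [Finset.mem_filter, hA, Finset.mem_filter]; simp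
    · rw [Finset.mem_filter]; simp
  have hsum := Finset.sum_le_sum hV
  simp only [Finset.sum_add_distrib] at hsum
  -- `|A1| + |A \ A1| = |A|`
  have hsub : A1 ⊆ A := Finset.filter_subset _ _
  have hsplit : A1.card + (A.filter (· ∉ A1)).card = A.card := by
    have h := Finset.card_filter_add_card_filter_not (s := A) (p := fun j => j ∈ A1)
    rw [Finset.filter_mem_eq_inter, Finset.inter_eq_right.mpr hsub] at h
    exact h
  -- casts
  have hT' : (A.card : ℝ) + ((A.filter (· ∉ A1)).card : ℝ) ≤
      ∑ v ∈ Mset, ((A.filter (fun i => ∃ a, N.src a = N.source i ∧ N.tgt a = v ∧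
        ∃ y y' : ι → Bool, c.val a y ≠ c.val a y')).card : ℝ) := by
    exact_mod_cast hT
  have hS' : 2 * (A.card : ℝ) ≤ ∑ i ∈ A, ((N.inArcs (N.sink i)).card : ℝ) +
      ∑ v ∈ Mset, ((A.filter (fun i => (N.inArcs (N.sink i)).card ≤ 1 ∧
        ∃ b ∈ N.inArcs (N.sink i), N.src b = v)).card : ℝ) := by
    exact_mod_cast hS
  have hsplit' : (A1.card : ℝ) + ((A.filter (· ∉ A1)).card : ℝ) = A.card := by
    exact_mod_cast hsplit
  linarith

end Level

end Summit.PneNP.PneNP.Theorems
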